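import Literature.NumberTheory.Automorphic.LevelControlDegreeZeroShift
import Literature.NumberTheory.Automorphic.HidaLevelDegreeZeroShift
import Literature.NumberTheory.Automorphic.HidaLevelAdaptedFamily
import Literature.NumberTheory.Automorphic.SymCoeffLatticeUpNilpotent
import Literature.NumberTheory.Automorphic.AshSmithTheoryHeckeLevelProofs
import Literature.NumberTheory.Automorphic.SymPowIwahoriCoefficients
import Literature.NumberTheory.Automorphic.CompletedCohomologyGLHecke
import HarnessLib

/-!
# `U_p` is nilpotent on `H⁰(Γ, 𝓕(N))` for the coefficients `⨂_τ Sym^{k−2}` modulo a nilpotent ideal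

Topic `NumberTheory/Automorphic`; namespaces `Literature.NumberTheory.Automorphic.ParallelWeight` and
`…BigHeckeGLn.TameLevel`; one definition with body (`principalLevel`) and theorems; no named fact,
no `sorry`.

The input `h₃`/`hC` ("`(U^𝓕)^m` kills `H⁰(𝓕 N)`") of the exact finite-level control in degree one
(`LevelControlFiniteLevel`, B1/B2) for `GL₂`, the Hida levels `U(c,c) ⊴ U(b',c)` and the LATTICE
coefficients `τ = ⨂_τ Sym^{k−2}(S²)` (`symLatticeAction S … red`) over a coefficient ring `S` in
which the uniformiser at `v₀ ∣ p` generates a nilpotent ideal `I` (`S = 𝒪/pⁿ`):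

* `ParallelWeight.symLatticeAction_eq_one_of_forall` — the lattice action of `g` is trivial when all
  its reduced local matrices are `1`;
* `TameLevel.principalLevel N` — the principal level `{u ∈ U : u_w ≡ 1 mod ϖ_w^N, w ∣ p}`; it is open,
  contained in `U(b,c)` for `N ≥ b, c`, and the lattice action is trivial on it as soon as the place
  maps kill the elements of valuation `≤ |ϖ|^N` (`symLatticeAction_eq_one_of_mem_principalLevel`);
* `TameLevel.intMatrixAt_conjUnipotent_*` — the local matrices of the conjugated representatives
  `N(x_j) t_{v₀} N(−x_j)`: `(0,0)`-entry `red(ϖ)`, `(1,0)`-entry `0`, `(1,1)`-entry `1` above `v₀`,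
  identity elsewhere;
* **`TameLevel.inducedHeckeCohomology_zero_pow_eq_zero_sym`** — `(U^𝓕)^{2m} = 0` on `H⁰(Γ, 𝓕(N))`
  for every `Q`-module `N` (`Q = U(b',c)/U(c,c)`), when `I^m` kills the lattice, `red_τ(ϖ_{v₀}) ∈ I`
  above `v₀` and `#(U t U/U) ∈ I`: `LevelControlDegreeZeroShift` (strong approximation,
  `HidaLevelDegreeZeroShift.apply_mul_unipotentFamily_eq`) plus `SymCoeffLatticeUpNilpotent`.

[cite: Hida1994AIF, §3, proof of Thm 3.2 (e kills H⁰)] [cite: KhareThorne2017, §6.3]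

## References

* H. Hida, Ann. Inst. Fourier 44 (1994), §3 (held). [Hida1994AIF]
* C. Khare, J. A. Thorne, Amer. J. Math. 139 (2017), §6.2–6.3 (arXiv:1409.7007, held). [KhareThorne2017]
-/

noncomputable section

open CategoryTheory IsDedekindDomain
open scoped NumberField TensorProduct

namespace Literature.NumberTheory.Automorphic

/-! ### The lattice action is trivial when the reduced local matrices are -/

namespace ParallelWeight

open BigHeckeGLn IntegralWeightGL2

variable (S : Type) [CommRing S] (E : Type) [Field E] [CharZero E] (F : Type) [Field F] [NumberField F]
  (k : ℕ) (v : (F →+* E) → HeightOneSpectrum (𝓞 F)) (red : ∀ τ : F →+* E, (v τ).adicCompletionIntegers F →+* S)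

omit [CharZero E] in
/-- **`symLatticeAction(g) = 1` when `intMatrixAt_τ(g) = 1` for all `τ`.** [folklore] -/
theorem symLatticeAction_eq_one_of_forall (g : integralMonoid F v) (h : ∀ τ, intMatrixAt S F v red τ g = 1) :
    symLatticeAction S E F k v red g = 1 := by
  refine LinearMap.ext fun x => ?_
  induction x using SymCoeffLattice.induction_on with
  | smul_tprod r x =>
    rw [map_smul, symLatticeAction_tprod, Module.End.one_apply]
    congr 1
    exact congrArg ltprod (funext fun τ => by rw [h τ, map_one, Module.End.one_apply])
  | add y z hy hz => rw [map_add, hy, hz, Module.End.one_apply, Module.End.one_apply, Module.End.one_apply]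

omit [CharZero E] in
/-- `intMatrixAt_τ(g) = 1` when the local component of `g` at `v(τ)` is `1`. [folklore] -/
theorem intMatrixAt_eq_one_of_localComponent_eq_one (g : integralMonoid F v) (τ : F →+* E)
    (h : localComponent 2 F (v τ) (g : FiniteAdelicGL 2 F) = 1) : intMatrixAt S F v red τ g = 1 := by
  have h1 : localIntAt F v τ g = 1 := Subtype.ext h
  change (red τ).mapMatrix (toIntMatrix F 2 (v τ) (localIntAt F v τ g)) = 1
  rw [h1, map_one, map_one]

end ParallelWeight

/-! ### The principal level and the triviality of the lattice action on it -/

namespace BigHeckeGLn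

/-- `K(ϖ^N) ≤ Iw(b, c)` for `N ≥ b`, `N ≥ c` (valued congruence subgroup inside the Iwahori level).
[folklore] -/
theorem valuedCongruenceSubgroup_le_iwahoriLevel {K : Type} [Field K] [NumberField K]
    (w : HeightOneSpectrum (𝓞 K)) {N b c : ℕ} (hb : b ≤ N) (hc : c ≤ N) :
    (valuedCongruenceSubgroup (Fin 2) (WithZero.exp (-(N : ℤ)) : WithZero (Multiplicative ℤ)) :
        Subgroup (GL (Fin 2) (w.adicCompletion K))) ≤ iwahoriLevel 2 w b c := by
  have hN : ∀ {m : ℕ}, m ≤ N →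
      (WithZero.exp (-(N : ℤ)) : WithZero (Multiplicative ℤ)) ≤ WithZero.exp (-(m : ℤ)) := fun hm =>
    WithZero.exp_le_exp.2 (neg_le_neg (Int.ofNat_le.2 hm))
  have hcond : ∀ g : GL (Fin 2) (w.adicCompletion K),
      g ∈ (valuedCongruenceSubgroup (Fin 2) (WithZero.exp (-(N : ℤ)) : WithZero (Multiplicative ℤ)) :
        Subgroup (GL (Fin 2) (w.adicCompletion K))) →
      IwahoriCond (Fin 2) (WithZero.exp (-(b : ℤ)) : WithZero (Multiplicative ℤ)) (WithZero.exp (-(c : ℤ)))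
        (g : Matrix (Fin 2) (Fin 2) (w.adicCompletion K)) := fun g hg => by
    obtain ⟨h₁, -, h₃⟩ := mem_valuedCongruenceSubgroup_iff.1 hg
    refine ⟨h₁, fun i j hij => ?_, fun i => ?_⟩
    swap
    · have h := h₃ i i
      rw [Matrix.sub_apply, Matrix.one_apply_eq] at h
      exact h.trans (hN hb)
    have hne : i ≠ j := fun h => (lt_irrefl _ (h ▸ hij))
    have h := h₃ i j
    rw [Matrix.sub_apply, Matrix.one_apply_ne hne, sub_zero] at h
    exact h.trans (le_min (hN hb) (hN hc))
  intro g hg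
  exact mem_valuedIwahoriSubgroup_iff.2 ⟨hcond g hg, hcond g⁻¹ (inv_mem hg)⟩

namespace TameLevel

open IntegralWeightGL2 LevelAction ParallelWeight

variable {K : Type} [Field K] [NumberField K] {p : ℕ} [Fact p.Prime] (𝒰 : TameLevel 2 K p)

/-- **The principal level `U_N = {u ∈ U : u_w ≡ 1 mod ϖ_w^N for all w ∣ p}`.** [folklore] -/
def principalLevel (N : ℕ) : Subgroup (FiniteAdelicGL 2 K) :=
  𝒰.levelAt fun _ => valuedCongruenceSubgroup (Fin 2) (WithZero.exp (-(N : ℤ)) : WithZero (Multiplicative ℤ))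

/-- `U_N` is open. [folklore] -/
theorem isOpen_principalLevel (N : ℕ) : IsOpen (𝒰.principalLevel N : Set (FiniteAdelicGL 2 K)) :=
  𝒰.isOpen_levelAt _ fun w => isOpen_valuedCongruenceSubgroup_of_ne_zero (K := K) (v := w.1) 2 WithZero.exp_ne_zero

/-- `U_N ≤ U(b, c)` for `N ≥ b, c`. [folklore] -/
theorem principalLevel_le_level {N b c : ℕ} (hb : b ≤ N) (hc : c ≤ N) : 𝒰.principalLevel N ≤ 𝒰.level b c :=
  𝒰.levelAt_mono fun w => valuedCongruenceSubgroup_le_iwahoriLevel w.1 hb hc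

variable {S : Type} [CommRing S] {E : Type} [Field E] (k : ℕ) {v : (K →+* E) → HeightOneSpectrum (𝓞 K)}
  (hv : ∀ τ, (p : 𝓞 K) ∈ (v τ).asIdeal) (red : ∀ τ : K →+* E, (v τ).adicCompletionIntegers K →+* S)

include hv in
/-- **The reduced local matrices of `u ∈ U_N` are `1`** when the place maps kill the elements of
valuation `≤ |ϖ|^N`. [folklore] -/
theorem intMatrixAt_eq_one_of_mem_principalLevel {N : ℕ}
    (hredN : ∀ τ (x : (v τ).adicCompletionIntegers K),
      Valued.v (x : (v τ).adicCompletion K) ≤ (WithZero.exp (-(N : ℤ)) : WithZero (Multiplicative ℤ)) → red τ x = 0)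
    {u : FiniteAdelicGL 2 K} (hu : u ∈ 𝒰.principalLevel N) (huΔ : u ∈ integralMonoid K v) (τ : K →+* E) :
    intMatrixAt S K v red τ ⟨u, huΔ⟩ = 1 := by
  have hloc := ((𝒰.mem_levelAt_iff _ u).1 hu).2 (v τ) (hv τ)
  obtain ⟨h₁, -, h₃⟩ := mem_valuedCongruenceSubgroup_iff.1 hloc
  refine Matrix.ext fun i j => ?_
  rw [intMatrixAt_apply]
  -- the integral entry `u_{ij}` is `δ_{ij} +` an element of valuation `≤ |ϖ|^N`
  have hint : ((localComponent 2 K (v τ) u : GL (Fin 2) ((v τ).adicCompletion K)) :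
      Matrix (Fin 2) (Fin 2) ((v τ).adicCompletion K)) i j - (1 : Matrix (Fin 2) (Fin 2) ((v τ).adicCompletion K)) i j ∈
        (v τ).adicCompletionIntegers K := by
    refine sub_mem ((HeightOneSpectrum.mem_adicCompletionIntegers (R := 𝓞 K) K _).2 (h₁ i j)) ?_
    by_cases hij : i = j
    · subst hij; rw [Matrix.one_apply_eq]; exact one_mem _
    · rw [Matrix.one_apply_ne hij]; exact zero_mem _
  have hval : Valued.v (((⟨_, hint⟩ : (v τ).adicCompletionIntegers K) : (v τ).adicCompletion K)) ≤
      (WithZero.exp (-(N : ℤ)) : WithZero (Multiplicative ℤ)) := by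
    change Valued.v (_ - _) ≤ _
    rw [← Matrix.sub_apply]
    exact h₃ i j
  have hentry : toIntMatrix K 2 (v τ) (localIntAt K v τ ⟨u, huΔ⟩) i j =
      (if i = j then 1 else 0) + ⟨_, hint⟩ := by
    refine Subtype.ext ?_
    change ((localComponent 2 K (v τ) u : GL (Fin 2) ((v τ).adicCompletion K)) :
        Matrix (Fin 2) (Fin 2) ((v τ).adicCompletion K)) i j = _
    split_ifs with hij
    · subst hij
      change _ = (1 : (v τ).adicCompletion K) + (_ - _)
      rw [Matrix.one_apply_eq]; ring
    · change _ = ((0 : (v τ).adicCompletionIntegers K) : (v τ).adicCompletion K) + (_ - _)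
      rw [Matrix.one_apply_ne hij, ZeroMemClass.coe_zero]; ring
  rw [hentry, map_add, hredN τ _ hval, add_zero]
  split_ifs with hij
  · subst hij; rw [map_one, Matrix.one_apply_eq]
  · rw [map_zero, Matrix.one_apply_ne hij]

include hv in
/-- **The lattice action is trivial on `U_N`** (place maps killing valuation `≤ |ϖ|^N`). [folklore] -/
theorem symLatticeAction_eq_one_of_mem_principalLevel [CharZero E] {N : ℕ}
    (hredN : ∀ τ (x : (v τ).adicCompletionIntegers K),
      Valued.v (x : (v τ).adicCompletion K) ≤ (WithZero.exp (-(N : ℤ)) : WithZero (Multiplicative ℤ)) → red τ x = 0)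
    {u : FiniteAdelicGL 2 K} (hu : u ∈ 𝒰.principalLevel N) (huΔ : u ∈ integralMonoid K v) :
    symLatticeAction S E K k v red ⟨u, huΔ⟩ = 1 :=
  symLatticeAction_eq_one_of_forall S E K k v red _ fun τ => 𝒰.intMatrixAt_eq_one_of_mem_principalLevel hv red hredN hu huΔ τ

/-! ### The local matrices of the conjugated unipotent representatives -/

variable {v₀ : HeightOneSpectrum (𝓞 K)}

/-- The local component of `N(x) t_{v₀} N(y)` at `v₀`: `(ϖ, ϖ y + x; 0, 1)`. [folklore] -/
theorem coe_localComponent_unipotent_mul_heckeElement_mul_unipotent (x y : v₀.adicCompletion K) (i j : Fin 2) :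
    ((localComponent 2 K v₀ (globalUnipotent K v₀ x * heckeElement 2 K v₀ 1 ^ 1 * globalUnipotent K v₀ y) :
        GL (Fin 2) (v₀.adicCompletion K)) : Matrix (Fin 2) (Fin 2) (v₀.adicCompletion K)) i j =
      if i = 0 then (if j = 0 then ((uniformizerAt v₀ : (v₀.adicCompletion K)ˣ) : v₀.adicCompletion K)
        else ((uniformizerAt v₀ : (v₀.adicCompletion K)ˣ) : v₀.adicCompletion K) * y + x)
      else (if j = 0 then 0 else 1) := by
  rw [map_mul, map_mul, localComponent_globalUnipotent, localComponent_globalUnipotent, Units.val_mul, Units.val_mul,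
    coe_localUnipotent, coe_localUnipotent]
  simp only [Matrix.mul_apply, Fin.sum_univ_two, Matrix.add_apply, Matrix.one_apply, Matrix.single_apply,
    coe_localComponent_heckeElement_one_pow_apply K v₀ 1]
  fin_cases i <;> fin_cases j <;> simp

/-- The conjugated representative `N(x) t_{v₀} N(y)` (`x, y` integral) lies in the integral monoid of any
family of places above `p`. [folklore] -/
theorem unipotent_mul_heckeElement_mul_unipotent_mem_integralMonoid
    {x y : v₀.adicCompletion K} (hx : Valued.v x ≤ 1) (hy : Valued.v y ≤ 1) :
    globalUnipotent K v₀ x * heckeElement 2 K v₀ 1 ^ 1 * globalUnipotent K v₀ y ∈ integralMonoid K v := by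
  refine (mem_integralMonoid_iff _).2 fun τ i j => ?_
  by_cases hτ : v τ = v₀
  · subst hτ
    rw [coe_localComponent_unipotent_mul_heckeElement_mul_unipotent]
    have hϖ := uniformizerAt_mem_adicCompletionIntegers K (v τ)
    split_ifs
    · exact hϖ
    · exact add_mem (mul_mem hϖ ((HeightOneSpectrum.mem_adicCompletionIntegers (R := 𝓞 K) K _).2 hy))
        ((HeightOneSpectrum.mem_adicCompletionIntegers (R := 𝓞 K) K _).2 hx)
    · exact zero_mem _
    · exact one_mem _
  · have h1 : localComponent 2 K (v τ) (globalUnipotent K v₀ x * heckeElement 2 K v₀ 1 ^ 1 * globalUnipotent K v₀ y) = 1 := by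
      rw [map_mul, map_mul, globalUnipotent, globalUnipotent, localComponent_ofLocal_of_ne hτ,
        localComponent_ofLocal_of_ne hτ, pow_one, localComponent_heckeElement_of_ne hτ, mul_one, mul_one]
    rw [h1, Units.val_one]
    by_cases hij : i = j
    · subst hij; rw [Matrix.one_apply_eq]; exact one_mem _
    · rw [Matrix.one_apply_ne hij]; exact zero_mem _

/-- **The reduced local matrices of `N(x) t_{v₀} N(y)`**: above `v₀` the `(0,0)`-entry is `red(ϖ)`, the
`(1,0)`-entry `0`, the `(1,1)`-entry `1`; elsewhere the matrix is `1`. [folklore] -/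
theorem intMatrixAt_unipotent_mul_heckeElement_mul_unipotent
    {x y : v₀.adicCompletion K} (hx : Valued.v x ≤ 1) (hy : Valued.v y ≤ 1) (τ : K →+* E) :
    (v τ = v₀ →
      intMatrixAt S K v red τ ⟨_, unipotent_mul_heckeElement_mul_unipotent_mem_integralMonoid hx hy⟩ 1 0 = 0 ∧
      intMatrixAt S K v red τ ⟨_, unipotent_mul_heckeElement_mul_unipotent_mem_integralMonoid hx hy⟩ 1 1 = 1 ∧
      intMatrixAt S K v red τ ⟨_, unipotent_mul_heckeElement_mul_unipotent_mem_integralMonoid hx hy⟩ 0 0 =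
        red τ ⟨_, uniformizerAt_mem_adicCompletionIntegers K (v τ)⟩) ∧
    (v τ ≠ v₀ →
      intMatrixAt S K v red τ ⟨_, unipotent_mul_heckeElement_mul_unipotent_mem_integralMonoid hx hy⟩ = 1) := by
  constructor
  · intro hτ
    subst hτ
    have hent : ∀ i j, toIntMatrix K 2 (v τ) (localIntAt K v τ
        ⟨_, unipotent_mul_heckeElement_mul_unipotent_mem_integralMonoid hx hy⟩) i j =
        ⟨_, (mem_integralMonoid_iff _).1
          (unipotent_mul_heckeElement_mul_unipotent_mem_integralMonoid hx hy) τ i j⟩ := fun i j => rfl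
    refine ⟨?_, ?_, ?_⟩
    · rw [intMatrixAt_apply, hent]
      have h0 : (⟨_, (mem_integralMonoid_iff _).1
          (unipotent_mul_heckeElement_mul_unipotent_mem_integralMonoid (v := v) hx hy) τ 1 0⟩ :
            (v τ).adicCompletionIntegers K) = 0 :=
        Subtype.ext (by
          change ((localComponent 2 K (v τ) (globalUnipotent K (v τ) x * heckeElement 2 K (v τ) 1 ^ 1 * globalUnipotent K (v τ) y) :
              GL (Fin 2) ((v τ).adicCompletion K)) : Matrix (Fin 2) (Fin 2) ((v τ).adicCompletion K)) 1 0 = 0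
          rw [coe_localComponent_unipotent_mul_heckeElement_mul_unipotent]; simp)
      rw [h0, map_zero]
    · rw [intMatrixAt_apply, hent]
      have h1 : (⟨_, (mem_integralMonoid_iff _).1
          (unipotent_mul_heckeElement_mul_unipotent_mem_integralMonoid (v := v) hx hy) τ 1 1⟩ :
            (v τ).adicCompletionIntegers K) = 1 :=
        Subtype.ext (by
          change ((localComponent 2 K (v τ) (globalUnipotent K (v τ) x * heckeElement 2 K (v τ) 1 ^ 1 * globalUnipotent K (v τ) y) :
              GL (Fin 2) ((v τ).adicCompletion K)) : Matrix (Fin 2) (Fin 2) ((v τ).adicCompletion K)) 1 1 = 1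
          rw [coe_localComponent_unipotent_mul_heckeElement_mul_unipotent]; simp)
      rw [h1, map_one]
    · rw [intMatrixAt_apply, hent]
      congr 1
      refine Subtype.ext ?_
      change ((localComponent 2 K (v τ) (globalUnipotent K (v τ) x * heckeElement 2 K (v τ) 1 ^ 1 * globalUnipotent K (v τ) y) :
          GL (Fin 2) ((v τ).adicCompletion K)) : Matrix (Fin 2) (Fin 2) ((v τ).adicCompletion K)) 0 0 = _
      rw [coe_localComponent_unipotent_mul_heckeElement_mul_unipotent]; simp
  · intro hτ
    refine intMatrixAt_eq_one_of_localComponent_eq_one S E K v red _ τ ?_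
    change localComponent 2 K (v τ) (globalUnipotent K v₀ x * heckeElement 2 K v₀ 1 ^ 1 * globalUnipotent K v₀ y) = 1
    rw [map_mul, map_mul, globalUnipotent, globalUnipotent, localComponent_ofLocal_of_ne hτ,
      localComponent_ofLocal_of_ne hτ, pow_one, localComponent_heckeElement_of_ne hτ, mul_one, mul_one]

/-! ### `U_p` is nilpotent on `H⁰(Γ, 𝓕(N))` -/

section Nilpotent

variable [CharZero E] {b' c : ℕ} (hb' : b' ≤ c) (hc : 1 ≤ c) [((𝒰.level c c).subgroupOf (𝒰.level b' c)).Normal]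
  {N : Type} [AddCommGroup N] [Module S N]
  (ρ : Representation S (𝒰.level b' c ⧸ (𝒰.level c c).subgroupOf (𝒰.level b' c)) N)
  (hU' : (𝒰.level b' c).toSubmonoid ≤ integralMonoid K v)

include hv in
/-- **`(U^𝓕)^{2m} = 0` on `H⁰(Γ, 𝓕(N))` for the coefficients `⨂_τ Sym^{k−2}(S²)`** and the unipotent
adapted family of `t_{v₀}` at `U(c,c) ⊴ U(b',c)`, when an ideal `I` of `S` with `I^m · V = 0` contains
`red_τ(ϖ)` above `v₀` and `#(U t U/U)`, and the place maps kill valuation `≤ |ϖ|^{N₀}` for some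
`N₀ ≥ c`. [cite: Hida1994AIF, §3, proof of Thm 3.2] [cite: KhareThorne2017, §6.3] -/
theorem inducedHeckeCohomology_zero_pow_eq_zero_sym (h𝒰 : 𝒰.IsMaximalAbove) (hv₀ : (p : 𝓞 K) ∈ v₀.asIdeal)
    (hΔ : ∀ j, 𝒰.unipotentFamily (v := v₀) c 1 j ∈ integralMonoid K v) {N₀ : ℕ} (hN₀ : c ≤ N₀)
    (hredN : ∀ τ (x : (v τ).adicCompletionIntegers K),
      Valued.v (x : (v τ).adicCompletion K) ≤ (WithZero.exp (-(N₀ : ℤ)) : WithZero (Multiplicative ℤ)) → red τ x = 0)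
    (I : Ideal S) {m : ℕ} (hI : I ^ m • (⊤ : Submodule S (SymCoeffLattice S E K k)) = ⊥)
    (hϖ : ∀ τ, v τ = v₀ → red τ ⟨_, uniformizerAt_mem_adicCompletionIntegers K (v τ)⟩ ∈ I)
    (hJ : (Fintype.card (ArithmeticQuotient.doubleCosetQuot (𝒰.level c c) (heckeElement 2 K v₀ 1 ^ 1)) : S) ∈ I) :
    inducedHeckeCohomology (globalEmbedding 2 K) (symLatticeAction S E K k v red) hU'
        (QuotientGroup.mk' ((𝒰.level c c).subgroupOf (𝒰.level b' c))) (ρ := ρ)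
        (𝒰.isAdaptedFamily_unipotentFamily h𝒰 hv₀ hc hb' hc hΔ) 0 ^ (2 * m) = 0 := by
  classical
  have ha := 𝒰.isAdaptedFamily_unipotentFamily (v := v₀) h𝒰 hv₀ hc hb' hc hΔ
  -- integrality of the `x_j`
  have hx1 : ∀ j : ArithmeticQuotient.doubleCosetQuot (𝒰.level c c) (heckeElement 2 K v₀ 1 ^ 1),
      Valued.v (𝒰.unipotentRep v₀ c 1 j) ≤ 1 := fun j => (𝒰.unipotentRep_spec h𝒰 hv₀ hc j.2).1
  have hxn1 : ∀ j : ArithmeticQuotient.doubleCosetQuot (𝒰.level c c) (heckeElement 2 K v₀ 1 ^ 1),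
      Valued.v (-𝒰.unipotentRep v₀ c 1 j) ≤ 1 := fun j => by rw [Valuation.map_neg]; exact hx1 j
  have hmemN : ∀ j : ArithmeticQuotient.doubleCosetQuot (𝒰.level c c) (heckeElement 2 K v₀ 1 ^ 1),
      globalUnipotent K v₀ (-𝒰.unipotentRep v₀ c 1 j) ∈ integralMonoid K v := fun j =>
    hU' ((𝒰.globalUnipotent_mem_level_iff h𝒰 hv₀ b' c _).2 (hxn1 j))
  -- the shift endomorphisms `e_j = τ(N(-x_j))`
  set e : ArithmeticQuotient.doubleCosetQuot (𝒰.level c c) (heckeElement 2 K v₀ 1 ^ 1) →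
      Module.End S (SymCoeffLattice S E K k) := fun j => symLatticeAction S E K k v red ⟨_, hmemN j⟩ with he
  refine inducedHeckeCohomology_zero_pow_eq_zero_of_shift (globalEmbedding 2 K) _ hU' _ ρ ha
    (heckeElement 2 K v₀ 1 ^ 1) e (fun F hF hinv g j => ?_) ?_
  · -- strong approximation: `F(g N(x_j) t) = (1 ⊗ τ(N(-x_j))) F(g t)`
    exact 𝒰.apply_mul_unipotentFamily_eq (symLatticeAction S E K k v red) hU' ρ h𝒰 hv₀ hc hb'
      (𝒰.isOpen_principalLevel N₀) (𝒰.principalLevel_le_level hN₀ hN₀)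
      (fun w hw => 𝒰.symLatticeAction_eq_one_of_mem_principalLevel k hv red hredN hw _) hF hinv g j
  · -- `B' = ∑_j τ(N(x_j) t N(-x_j))` is nilpotent
    have hsum : (∑ j, symLatticeAction S E K k v red ⟨𝒰.unipotentFamily c 1 j, ha.mem j⟩ * e j) =
        ∑ j, symLatticeAction S E K k v red
          ⟨_, unipotent_mul_heckeElement_mul_unipotent_mem_integralMonoid (hx1 j) (hxn1 j)⟩ := by
      refine Finset.sum_congr rfl fun j _ => ?_
      rw [he, ← map_mul]
      rfl
    rw [hsum]
    refine sum_symLatticeAction_pow_eq_zero S E K k v red I hI hJ _ {τ | v τ = v₀}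
      (fun j τ hτ => ?_) (fun j τ hτ => ?_) (fun j τ hτ => ?_) (fun j τ hτ => ?_)
    · rw [((intMatrixAt_unipotent_mul_heckeElement_mul_unipotent red (hx1 j) (hxn1 j) τ).1 hτ).2.2]
      exact hϖ τ hτ
    · exact ((intMatrixAt_unipotent_mul_heckeElement_mul_unipotent red (hx1 j) (hxn1 j) τ).1 hτ).1
    · exact ((intMatrixAt_unipotent_mul_heckeElement_mul_unipotent red (hx1 j) (hxn1 j) τ).1 hτ).2.1
    · exact (intMatrixAt_unipotent_mul_heckeElement_mul_unipotent red (hx1 j) (hxn1 j) τ).2 hτ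

end Nilpotent

end TameLevel

end BigHeckeGLn

end Literature.NumberTheory.Automorphic
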